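import Summits.CriticalPhenomena.CardyFormulaZ2.Theses.CardyHausdorffMoment

/-!
# r1 strategist (2026-08-17): where the deciding crux `LogConvexApproach` sits relative to the summit

Kernel-checked bookkeeping for STRATEGY-CENSUS.md of crux stmt-CriticalPhenomena-9807:

1. `closes_of_hardWayLimits` — the route's deciding theorem consumes `LogConvexApproach` ONLY through the
   support `HardWayLimits` (existence of the hard-way box-crossing limits): the same proof closes the
   sub-problem from `HardWayLimits` in place of `LogConvexApproach` + `LimitsFromLogConvex`.
2. `rectValue_of_cardyFormulaZ2`, `confInvTransport_of_cardyFormulaZ2` — the two other open load-bearing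
   cruxes are CONSEQUENCES of the summit (uniqueness of limits), i.e. the imported value / invariance halves.
3. `logConvexApproach_enters_via` — `LimitsFromLogConvex LogConvexApproach : HardWayLimits` by `rfl`-typing.

So modulo the provable supports (`RectModulus`, `HardWayGlue`, `RectRealises`, `LimitsFromLogConvex`):
`HardWayLimits ∧ RectValue ∧ ConfInvTransport → CardyFormulaZ2` (item 1) and `CardyFormulaZ2 → RectValue ∧
ConfInvTransport` (item 2); `CardyFormulaZ2 → HardWayLimits` holds by the routine box sandwich (by reading, not
landed here); `LogConvexApproach → HardWayLimits` is the elementary support; neither `LogConvexApproach →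
CardyFormulaZ2` nor `CardyFormulaZ2 → LogConvexApproach` (probes `bc/LogConvexApproach_{probe,converse,bc7}.lean`).
-/

namespace Summit.CriticalPhenomena.CardyFormulaZ2.Theses.CardyHausdorffMoment

open Filter Topology

/-- The deciding theorem of route CardyHausdorffMoment with the deciding crux replaced by the support
`HardWayLimits` — same proof term as `closes`, so `LogConvexApproach` is load-bearing only via existence. -/
theorem closes_of_hardWayLimits (hH : HardWayLimits) (h4 : RectValue) (h5 : ConfInvTransport)
    (h9 : RectModulus) (h10 : HardWayGlue) (h11 : RectRealises) : _root_.CardyFormulaZ2 := by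
  have hRect : RectCardy := h10 h9 hH h4
  intro R' φ' x' huni'
  have hη' := Literature.Probability.RandomPlanarGeometry.ConformalRectangle.crossRatio_mem_Ioo_of_isUniformizing huni'
  obtain ⟨R, w, h, φ, x, hw, hh, hcar, hpts, huni, hη⟩ := h11 _ hη'
  have hlim := hRect R w h hw hh hcar hpts φ x huni
  have key := h5 R R' φ x φ' x' huni huni' hη _ hlim
  rw [hη] at key
  exact key

/-- `LogConvexApproach` enters `closes` exactly as `LimitsFromLogConvex LogConvexApproach : HardWayLimits`. -/
theorem logConvexApproach_enters_via (h7 : LimitsFromLogConvex) (h2 : LogConvexApproach) : HardWayLimits :=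
  h7 h2

/-- The value crux is a consequence of the summit (uniqueness of limits along `𝓝[>] 0`). -/
theorem rectValue_of_cardyFormulaZ2 (hS : _root_.CardyFormulaZ2) : RectValue := by
  intro R w h hw hh hcar hpts φ x huni L hL
  have hlim := hS R φ x huni
  exact tendsto_nhds_unique hL hlim

/-- The transport crux (conformal invariance in transport form) is a consequence of the summit. -/
theorem confInvTransport_of_cardyFormulaZ2 (hS : _root_.CardyFormulaZ2) : ConfInvTransport := by
  intro R R' φ x φ' x' huni huni' hη L hL
  have h1 := hS R φ x huni
  have h2 := hS R' φ' x' huni'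
  have hLeq : L = Literature.Probability.RandomPlanarGeometry.cardyFunction
      (Literature.Probability.RandomPlanarGeometry.crossRatio x) := tendsto_nhds_unique hL h1
  rw [hLeq, hη]
  exact h2

end Summit.CriticalPhenomena.CardyFormulaZ2.Theses.CardyHausdorffMoment
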